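import Literature.Analysis.FluidPDE.PeriodicCylinderNeumannWallSobolev
import Literature.Analysis.FunctionSpaces.SobolevSmoothUpToBoundary
import Literature.Analysis.FunctionSpaces.ConvexLipschitzDomain
import HarnessLib

/-!
# Smooth representatives of the weak periodic Neumann solution on convex pieces away from the axis

(module docstring completed below)
-/

noncomputable section

open MeasureTheory Set Function Filter Topology TopologicalSpace WithLp Metric Module
open scoped ContDiff NNReal ENNReal InnerProductSpace RealInnerProductSpace

namespace Literature.Analysis.FluidPDE

open Literature.Analysis.FunctionSpaces

/-- Local notation for physical space `ℝ³ = EuclideanSpace ℝ (Fin 3)`. -/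
local notation "ℝ³" => EuclideanSpace ℝ (Fin 3)

/-- Local notation for the closed unit cylinder `{r ≤ 1}`. -/
local notation "𝕂" => closure (SetLike.coe unitCylinder : Set (EuclideanSpace ℝ (Fin 3)))

namespace PeriodicCylinder

variable {L : ℝ}

/-! ### Smooth representatives on convex pieces -/

/-- **The potential is smooth up to the boundary on every convex piece of the cell away from the
axis**: for the weak Neumann solution `∇q[h₀,h₁]` with smooth periodic data (`∫_cell h₀ = 0`) and a
convex open `Ω' ⊆ cell` with `ρ > 1/4` on `Ω'`, the potential `q` agrees a.e. on `Ω'` with one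
continuous function which is `C^∞` on `closure Ω'` (Sobolev regularity of every order on the piece,
`memSobolevDomain_potential_neumannGrad`, and the imbedding `⋂ₖ W^{k,2} ⊂ C^∞(Ω̄')` on the convex —
hence bounded Lipschitz — piece, `exists_contDiffOn_closure_of_forall_memSobolevDomain`). [folklore] -/
theorem exists_smooth_rep_potential_of_convex (hL : 0 < L) {Ω' : Opens ℝ³} (hΩ : IsWallPiece L Ω')
    (hconv : Convex ℝ (Ω' : Set ℝ³)) {h₀ : ℝ³ → ℝ} {h₁ : ℝ³ → ℝ³} (hh₀ : IsSmoothPeriodic L h₀)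
    (hh₁ : IsSmoothPeriodic L h₁) (hmean : ∫ x in (cylinderCell L : Set ℝ³), h₀ x = 0) :
    ∃ f : ℝ³ → ℝ, Continuous f ∧ ContDiffOn ℝ ∞ f (closure (Ω' : Set ℝ³)) ∧
      (((potential (neumannGrad L (toCell L h₀) (toCell L h₁)) : Lp ℝ 2 (cellMeasure L)) : ℝ³ → ℝ) =ᵐ[
        volume.restrict Ω'] f) ∧
      ∀ m : ℕ, ∃ g : ℝ³ → ℝ, ContDiff ℝ m g ∧ EqOn f g (closure (Ω' : Set ℝ³)) := by
  have hk := fun k => memSobolevDomain_potential_neumannGrad hL hΩ hh₀ hh₁ hmean k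
  have hb : Bornology.IsBounded (Ω' : Set ℝ³) := (isBounded_cylinderCell L).subset hΩ.le_cell
  obtain ⟨f, hf, hfc, hfs, hreps⟩ := exists_contDiffOn_closure_of_forall_memSobolevDomain (μ := volume)
    (F := ℝ) finrank_euclideanSpace_fin (isLipschitzDomain_of_convex hconv hb) hb hk
  exact ⟨f, hfc, hfs, hf, hreps⟩

/-- **The weak gradient is the gradient of a smooth representative**: if the potential agrees
a.e. on an open `Ω' ⊆ cell` with a function `f` smooth on `Ω'`, then `∇q[h₀,h₁] = ∇f` a.e. on `Ω'`
(uniqueness of weak derivatives). [folklore] -/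
theorem coe_neumannGrad_ae_eq_gradient (hL : 0 < L) {Ω' : Opens ℝ³} (hle : Ω' ≤ cylinderCell L)
    {h₀ : ℝ³ → ℝ} {h₁ : ℝ³ → ℝ³} {f : ℝ³ → ℝ} (hfs : ContDiffOn ℝ ∞ f (Ω' : Set ℝ³))
    (hqf : (((potential (neumannGrad L (toCell L h₀) (toCell L h₁)) : Lp ℝ 2 (cellMeasure L)) : ℝ³ → ℝ) =ᵐ[
        volume.restrict Ω'] f)) :
    ((((neumannGrad L (toCell L h₀) (toCell L h₁) : gradSpace L) : Lp ℝ³ 2 (cellMeasure L)) : ℝ³ → ℝ³)) =ᵐ[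
        volume.restrict Ω'] fun x => gradient f x := by
  set Gg := neumannGrad L (toCell L h₀) (toCell L h₁) with hGg
  have hq := HasWeakFDerivOn.mono_set_holds (hasWeakFDerivOn_potential hL Gg) hle
  have hf := MeyersSerrin.hasWeakFDerivOn_of_contDiffOn (μ := volume) hfs
  have hq' : HasWeakFDerivOn Ω' volume f
      (fun x => (innerSL ℝ ((((Gg : gradSpace L) : Lp ℝ³ 2 (cellMeasure L)) : ℝ³ → ℝ³) x) : ℝ³ →L[ℝ] ℝ)) :=
    MeyersSerrin.hasWeakFDerivOn_congr_ae hq hqf.symm EventuallyEq.rfl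
  have hu := HasWeakFDerivOn.unique_holds hq' hf
  filter_upwards [hu] with x hx
  have h1 : (InnerProductSpace.toDual ℝ ℝ³) ((((Gg : gradSpace L) : Lp ℝ³ 2 (cellMeasure L)) : ℝ³ → ℝ³) x) =
      fderiv ℝ f x := by
    rw [← hx]; rfl
  rw [gradient, ← h1, LinearIsometryEquiv.symm_apply_apply]

/-! ### Balls away from the axis -/

/-- A ball inside the cell at distance `≥ 1/2` from the axis is a (convex) wall piece. [folklore] -/
theorem isWallPiece_ball {c : ℝ³} {ρ₀ : ℝ} (hsub : ball c ρ₀ ⊆ (cylinderCell L : Set ℝ³))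
    (hfar : ∀ x ∈ ball c ρ₀, (1 : ℝ) / 2 < cylRadius x) :
    IsWallPiece L ⟨ball c ρ₀, isOpen_ball⟩ where
  le_cell := hsub
  rsq_gt x hx := by
    have h := hfar x hx
    rw [norm_horizontalProj]
    nlinarith [cylRadius_nonneg x]

/-- The cylindrical radius is `1`-Lipschitz. [folklore] -/
theorem abs_cylRadius_sub_le (x y : ℝ³) : |cylRadius x - cylRadius y| ≤ ‖x - y‖ := by
  rw [← norm_horizontalProj, ← norm_horizontalProj]
  refine (abs_norm_sub_norm_le _ _).trans ?_
  rw [← map_sub, norm_horizontalProj]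
  exact cylRadius_le_norm _

/-- **Covariance of the potential in function form**: for the data shifted by `a`, the new weak
solution and potential are the old ones composed with the periodic shift, a.e. on the cell. [folklore] -/
theorem potential_shiftedData_ae_eq (hL : 0 < L) (a : ℝ) {h₀ : ℝ³ → ℝ} {h₁ : ℝ³ → ℝ³}
    (hh₀ : IsSmoothPeriodic L h₀) (hh₁ : IsSmoothPeriodic L h₁) :
    (((potential (neumannGrad L (toCell L fun x => h₀ (x + a • eZ)) (toCell L fun x => h₁ (x + a • eZ))) :
        Lp ℝ 2 (cellMeasure L)) : ℝ³ → ℝ) =ᵐ[cellMeasure L]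
      fun x => ((potential (neumannGrad L (toCell L h₀) (toCell L h₁)) : Lp ℝ 2 (cellMeasure L)) : ℝ³ → ℝ)
        (cellShift L a x)) ∧
    (((((neumannGrad L (toCell L fun x => h₀ (x + a • eZ)) (toCell L fun x => h₁ (x + a • eZ)) : gradSpace L) :
        Lp ℝ³ 2 (cellMeasure L)) : ℝ³ → ℝ³)) =ᵐ[cellMeasure L]
      fun x => ((((neumannGrad L (toCell L h₀) (toCell L h₁) : gradSpace L) : Lp ℝ³ 2 (cellMeasure L)) : ℝ³ → ℝ³))
        (cellShift L a x)) := by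
  set Gg := neumannGrad L (toCell L h₀) (toCell L h₁) with hGg
  have h0 : toCell L (fun x => h₀ (x + a • eZ)) = axialShiftLp L a (toCell L h₀) :=
    (axialShiftLp_toCell hL a hh₀.periodic hh₀.memLp).symm
  have h1 : toCell L (fun x => h₁ (x + a • eZ)) = axialShiftLp L a (toCell L h₁) :=
    (axialShiftLp_toCell hL a hh₁.periodic hh₁.memLp).symm
  have hcoe : ((neumannGrad L (toCell L fun x => h₀ (x + a • eZ)) (toCell L fun x => h₁ (x + a • eZ)) : gradSpace L) :
      Lp ℝ³ 2 (cellMeasure L)) = axialShiftLp L a (Gg : Lp ℝ³ 2 (cellMeasure L)) := by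
    rw [h0, h1, coe_neumannGrad_axialShiftLp hL a]
  have hsub : neumannGrad L (toCell L fun x => h₀ (x + a • eZ)) (toCell L fun x => h₁ (x + a • eZ)) =
      ⟨axialShiftLp L a (Gg : Lp ℝ³ 2 (cellMeasure L)), axialShiftLp_mem_gradSpace hL a Gg.2⟩ :=
    Subtype.ext hcoe
  constructor
  · rw [hsub, potential_axialShiftLp hL a Gg]
    exact coeFn_axialShiftLp hL a _
  · rw [hcoe]
    exact coeFn_axialShiftLp hL a _

/-- Transport of an a.e. statement on a set under a translation. [folklore] -/
theorem ae_restrict_comp_sub_of_ae_restrict {p : ℝ³ → Prop} {s : Set ℝ³} (hs : MeasurableSet s) (v : ℝ³)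
    (h : ∀ᵐ y ∂(volume.restrict s), p y) :
    ∀ᵐ x ∂(volume.restrict ((fun x => x - v) ⁻¹' s)), p (x - v) := by
  rw [ae_restrict_iff' hs] at h
  rw [ae_restrict_iff' (measurable_sub_const v hs)]
  have hmp : MeasurePreserving (fun x : ℝ³ => x - v) volume volume := measurePreserving_sub_right volume v
  have hnull : volume {y : ℝ³ | ¬ (y ∈ s → p y)} = 0 := by
    rw [← ae_iff]; exact h
  have := hmp.preimage_null hnull
  rw [ae_iff]
  refine measure_mono_null (fun x hx => ?_) this
  simp only [mem_setOf_eq, mem_preimage, Classical.not_imp] at hx ⊢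
  exact hx

/-- **Local smooth representatives**: around every point of the open band
`{0.6 < r < 0.95} × ℝ` — seams included — the periodic extension `Q = q ∘ axialRed` of the
potential of `∇q[h₀,h₁]` agrees a.e. on a ball with a function smooth on a larger ball, whose
gradient is `∇q ∘ axialRed` a.e. The ball is first moved, by the shift `a = z₀ − L/2` of the data
(`IsSmoothPeriodic.comp_add_smul_eZ`; covariance `potential_shiftedData_ae_eq`), to mid-height of
the cell, where the previous theorems apply to a ball inside the cell. [folklore] -/
theorem exists_local_smooth_rep (hL : 0 < L) {h₀ : ℝ³ → ℝ} {h₁ : ℝ³ → ℝ³} (hh₀ : IsSmoothPeriodic L h₀)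
    (hh₁ : IsSmoothPeriodic L h₁) (hmean : ∫ x in (cylinderCell L : Set ℝ³), h₀ x = 0)
    {x₀ : ℝ³} (hr1 : 0.6 < cylRadius x₀) (hr2 : cylRadius x₀ < 0.95) :
    ∃ ρ₀ : ℝ, 0 < ρ₀ ∧ ∃ g : ℝ³ → ℝ, ContDiffOn ℝ ∞ g (ball x₀ (2 * ρ₀)) ∧
      (∀ᵐ x ∂(volume.restrict (ball x₀ (2 * ρ₀))),
        ((potential (neumannGrad L (toCell L h₀) (toCell L h₁)) : Lp ℝ 2 (cellMeasure L)) : ℝ³ → ℝ) (axialRed L x) = g x) ∧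
      (∀ᵐ x ∂(volume.restrict (ball x₀ (2 * ρ₀))),
        ((((neumannGrad L (toCell L h₀) (toCell L h₁) : gradSpace L) : Lp ℝ³ 2 (cellMeasure L)) : ℝ³ → ℝ³))
          (axialRed L x) = gradient g x) := by
  -- the shift and the shifted data
  set a : ℝ := x₀ 2 - L / 2 with ha
  set k₀ : ℝ³ → ℝ := fun x => h₀ (x + a • eZ) with hk₀
  set k₁ : ℝ³ → ℝ³ := fun x => h₁ (x + a • eZ) with hk₁
  have hk₀s : IsSmoothPeriodic L k₀ := hh₀.comp_add_smul_eZ a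
  have hk₁s : IsSmoothPeriodic L k₁ := hh₁.comp_add_smul_eZ a
  have hkmean : ∫ x in (cylinderCell L : Set ℝ³), k₀ x = 0 := by
    simp only [hk₀]
    rw [integral_comp_add_smul_eZ hL a hh₀.periodic hh₀.memLp.1, hmean]
  -- the ball at mid-height
  set ρ₀ : ℝ := min (1 / 40) (L / 8) with hρ₀
  have hρ₀pos : 0 < ρ₀ := lt_min (by norm_num) (by positivity)
  have hρ₀1 : ρ₀ ≤ 1 / 40 := min_le_left _ _
  have hρ₀2 : ρ₀ ≤ L / 8 := min_le_right _ _
  set c : ℝ³ := x₀ - a • eZ with hc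
  have hc2 : c 2 = L / 2 := by simp [hc, ha]
  have hcr : cylRadius c = cylRadius x₀ := by
    rw [hc, sub_eq_add_neg, ← neg_smul, cylRadius_add_smul_eZ]
  have hcoord : ∀ (x y : ℝ³), |y 2 - x 2| ≤ dist y x := fun x y => by
    rw [dist_eq_norm, ← Real.norm_eq_abs]
    have h := PiLp.norm_apply_le (y - x) 2
    simpa using h
  have hball_cell : ball c (2 * ρ₀) ⊆ (cylinderCell L : Set ℝ³) := fun y hy => by
    rw [mem_ball] at hy
    have hz := hcoord c y
    have hr := abs_cylRadius_sub_le y c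
    rw [← dist_eq_norm] at hr
    have hz' := abs_lt.1 (lt_of_le_of_lt hz hy)
    have hr' := abs_lt.1 (lt_of_le_of_lt hr hy)
    refine ⟨?_, ?_, ?_⟩
    · show cylRadius y < 1
      nlinarith [hr'.2, hcr]
    · nlinarith [hz'.1, hc2]
    · nlinarith [hz'.2, hc2]
  have hball_far : ∀ y ∈ ball c (2 * ρ₀), (1 : ℝ) / 2 < cylRadius y := fun y hy => by
    rw [mem_ball] at hy
    have hr := abs_cylRadius_sub_le y c
    rw [← dist_eq_norm] at hr
    have hr' := abs_lt.1 (lt_of_le_of_lt hr hy)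
    nlinarith [hr'.1, hcr]
  set B : Opens ℝ³ := ⟨ball c (2 * ρ₀), isOpen_ball⟩ with hB
  have hBw : IsWallPiece L B := isWallPiece_ball hball_cell hball_far
  -- smooth representative on the ball for the shifted data
  obtain ⟨f, hfc, hfs, hqf, -⟩ := exists_smooth_rep_potential_of_convex hL hBw (convex_ball c (2 * ρ₀)) hk₀s hk₁s hkmean
  have hfo : ContDiffOn ℝ ∞ f (ball c (2 * ρ₀)) := hfs.mono subset_closure
  have hGf := coe_neumannGrad_ae_eq_gradient hL hBw.le_cell hfo hqf
  obtain ⟨hcovq, hcovG⟩ := potential_shiftedData_ae_eq hL a hh₀ hh₁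
  -- on the ball: `f y = q (axialRed (y + a e_z))`, `∇f y = G (axialRed (y + a e_z))`
  have hBm : MeasurableSet (ball c (2 * ρ₀)) := isOpen_ball.measurableSet
  have hq_ball : ∀ᵐ y ∂(volume.restrict (ball c (2 * ρ₀))),
      ((potential (neumannGrad L (toCell L h₀) (toCell L h₁)) : Lp ℝ 2 (cellMeasure L)) : ℝ³ → ℝ) (axialRed L (y + a • eZ)) = f y := by
    have h1 : ∀ᵐ y ∂(volume.restrict (ball c (2 * ρ₀))), _ := ae_restrict_of_ae_restrict_of_subset hball_cell hcovq
    filter_upwards [h1, hqf] with y hy1 hy2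
    rw [← hy2, hy1, cellShift_apply]
  have hG_ball : ∀ᵐ y ∂(volume.restrict (ball c (2 * ρ₀))),
      ((((neumannGrad L (toCell L h₀) (toCell L h₁) : gradSpace L) : Lp ℝ³ 2 (cellMeasure L)) : ℝ³ → ℝ³)) (axialRed L (y + a • eZ)) =
        gradient f y := by
    have h1 : ∀ᵐ y ∂(volume.restrict (ball c (2 * ρ₀))), _ := ae_restrict_of_ae_restrict_of_subset hball_cell hcovG
    filter_upwards [h1, hGf] with y hy1 hy2
    rw [← hy2, hy1, cellShift_apply]
  -- translate back: `g = f (· − a e_z)`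
  have hpre : (fun x : ℝ³ => x - a • eZ) ⁻¹' ball c (2 * ρ₀) = ball x₀ (2 * ρ₀) := by
    ext x
    simp only [mem_preimage, mem_ball, hc, dist_eq_norm, sub_sub_sub_cancel_right]
  refine ⟨ρ₀, hρ₀pos, fun x => f (x - a • eZ), ?_, ?_, ?_⟩
  · intro x hx
    have hx' : x - a • eZ ∈ ball c (2 * ρ₀) := by rw [← hpre] at hx; exact hx
    exact ((hfo.contDiffAt (isOpen_ball.mem_nhds hx')).comp x (contDiffAt_id.sub contDiffAt_const)).contDiffWithinAt
  · have h := ae_restrict_comp_sub_of_ae_restrict hBm (a • eZ) hq_ball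
    rw [hpre] at h
    filter_upwards [h] with x hx
    rwa [sub_add_cancel] at hx
  · have h := ae_restrict_comp_sub_of_ae_restrict hBm (a • eZ) hG_ball
    rw [hpre] at h
    filter_upwards [h] with x hx
    rw [sub_add_cancel] at hx
    rw [hx, gradient, gradient]
    congr 1
    rw [show (fun x => f (x - a • eZ)) = fun x => f (x + -(a • eZ)) by funext; rw [sub_eq_add_neg], fderiv_comp_add_right,
      ← sub_eq_add_neg]

end PeriodicCylinder

end Literature.Analysis.FluidPDE
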